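import Mathlib
import HarnessLib
import Summits.NavierStokesRegularity.NavierStokesRegularity.Theorems.HalfSpaceWindowDoorCirculationCarryingRigidityTiltDominatedLiouville

/-!
# Route `HalfSpaceWindowDoor`, crux `CirculationCarryingRigidity` (stmt-NavierStokesRegularity-25311) — census theorem,
# AXIS-TYPE-I version: tilt-dominated closed-hemisphere profiles with `‖v(t,x)‖ ≤ D/(|x_h| + √(−t))` are trivial

The proof of `…TiltDominatedLiouville.eq_zero_of_hasTypeIDecay_signE3_globalCone` uses the space–time Type-I bound only
through the velocity bound `D/(r + √(−s))` on the axis circles `S(r,z)`.  Hence the same conclusion holds for the LARGER class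
with the AXIS-Type-I bound `‖v(t,x)‖ ≤ D/(|x_h| + √(−t))` (KNSS 2009 Thm 5.3's `|v| ≤ C/|x'|` blended with the Type-I rate; no
decay along the axis is required — e.g. axially periodic profiles are admitted): under the closed-hemisphere sign and the
slack-free circle-averaged cone about the vertical axis (`GlobalCone`), the profile vanishes identically
(`eq_zero_of_axisTypeI_signE3_globalCone`).  Census row for crux 25311: stratum {axis-Type I} ∩ {tilt-dominated} DEAD.

Seat ns-hsw-p1 g3 (LEAD of 25311, cell pub-ns-dss).  WHAT THIS IS NOT: not a statement about Navier–Stokes regularity;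
HYPOTHETICAL blow-up profiles; helper `--supports` 25311.
-/

noncomputable section

-- the summit and its single sub-problem share the name (CONVENTIONS §1), as in every Theorems file
set_option linter.dupNamespace false

namespace Summit.NavierStokesRegularity.NavierStokesRegularity.Theorems.HalfSpaceWindowDoorCirculationCarryingRigidityAxisTypeILiouville

open MeasureTheory Set Function Filter Topology TopologicalSpace InnerProductSpace WithLp Metric
open scoped Laplacian RealInnerProductSpace ContDiff Classical
open Literature.Analysis Literature.Analysis.FluidPDE
open Summit.NavierStokesRegularity.NavierStokesRegularity.Theorems.HalfSpaceWindowDoorCirculationCarryingRigidityDefs (IsSourcedSwirl)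
open Summit.NavierStokesRegularity.NavierStokesRegularity.Theorems.AxisTwistDoorAveragedConeLiouvilleDefs
  (cylPt eT e3 circ vortCirc radVortCirc tiltCirc circleTerm SignE3 GlobalCone)
open Summit.NavierStokesRegularity.NavierStokesRegularity.Theorems.AveragedConeLiouville.CircleStokes (deriv_circ_eq_vortCirc)
open Summit.NavierStokesRegularity.NavierStokesRegularity.Theorems.AveragedConeLiouville.CircMonotone
  (circ_zero vortCirc_zero vortCirc_nonneg circ_nonneg)
open Summit.NavierStokesRegularity.NavierStokesRegularity.Theorems.AveragedConeLiouville.FlatFlux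
  (eq_zero_of_signE3_globalCone_circ_eq_zero)
open Summit.NavierStokesRegularity.NavierStokesRegularity.Theorems.AveragedConeLiouville.ShellBookkeeping (cylRadius_cylPt)
open Summit.NavierStokesRegularity.NavierStokesRegularity.Theorems.AxisTwistDoorAveragedConeLiouvilleCircleToolkit (abs_circ_le)
open Summit.NavierStokesRegularity.NavierStokesRegularity.Theorems.HalfSpaceWindowDoorCirculationCarryingRigidityAxisCirculation
open Summit.NavierStokesRegularity.NavierStokesRegularity.Theorems.HalfSpaceWindowDoorCirculationCarryingRigidityAxisCirculationDynamics
open Summit.NavierStokesRegularity.NavierStokesRegularity.Theorems.HalfSpaceWindowDoorCirculationCarryingRigiditySourcedSwirlLiouville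
open Summit.NavierStokesRegularity.NavierStokesRegularity.Theorems.HalfSpaceWindowDoorCirculationCarryingRigidityTiltDominatedLiouville
  (circF_eqn)

variable {C D K : ℝ} {v : ℝ → EuclideanSpace ℝ (Fin 3) → EuclideanSpace ℝ (Fin 3)}

/-! ### The axis-Type-I bound on circles -/

/-- The axis-Type-I constant is non-negative. -/
theorem axisBound_nonneg (hDax : ∀ t < 0, ∀ x : EuclideanSpace ℝ (Fin 3), ‖v t x‖ ≤ D / (cylRadius x + Real.sqrt (-t))) :
    0 ≤ D := by
  have h := hDax (-1) (by norm_num) 0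
  have hc : cylRadius (0 : EuclideanSpace ℝ (Fin 3)) = 0 := by simp [cylRadius]
  rw [hc, zero_add] at h
  have hsq : 0 < Real.sqrt (-(-1 : ℝ)) := Real.sqrt_pos.2 (by norm_num)
  have h0 : 0 ≤ D / Real.sqrt (-(-1 : ℝ)) := (norm_nonneg _).trans h
  by_contra hneg
  have : D / Real.sqrt (-(-1 : ℝ)) < 0 := div_neg_of_neg_of_pos (lt_of_not_ge hneg) hsq
  linarith

/-- The velocity bound on an axis circle: `‖v(s)(cylPt r θ z)‖ ≤ D/(r + √(−s))`. -/
theorem norm_le_on_circle_of_axisBound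
    (hDax : ∀ t < 0, ∀ x : EuclideanSpace ℝ (Fin 3), ‖v t x‖ ≤ D / (cylRadius x + Real.sqrt (-t)))
    {s : ℝ} (hs : s < 0) {r : ℝ} (hr : 0 ≤ r) (θ z : ℝ) :
    ‖v s (cylPt r θ z)‖ ≤ D / (r + Real.sqrt (-s)) := by
  have h := hDax s hs (cylPt r θ z)
  rwa [cylRadius_cylPt hr] at h

/-- `|F| ≤ D` for the lifted normalised circulation under the axis-Type-I bound. -/
theorem abs_circF_le_of_axisBound
    (hDax : ∀ t < 0, ∀ x : EuclideanSpace ℝ (Fin 3), ‖v t x‖ ≤ D / (cylRadius x + Real.sqrt (-t)))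
    {s : ℝ} (hs : s < 0) (x : EuclideanSpace ℝ (Fin 3)) :
    |(2 * Real.pi)⁻¹ * circ v (cylRadius x) (x 2) s| ≤ D := by
  have hD0 : 0 ≤ D := axisBound_nonneg hDax
  by_cases hr0 : cylRadius x = 0
  · rw [hr0, circ_zero]; simp [hD0]
  have hr : 0 < cylRadius x := lt_of_le_of_ne (cylRadius_nonneg x) (Ne.symm hr0)
  have hsq : 0 < Real.sqrt (-s) := Real.sqrt_pos.2 (by linarith)
  have hB : ∀ θ : ℝ, ‖v s (cylPt (cylRadius x) θ (x 2))‖ ≤ D / (cylRadius x + Real.sqrt (-s)) :=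
    fun θ => norm_le_on_circle_of_axisBound hDax hs hr.le θ (x 2)
  have h := abs_circ_le hr hB
  have hπ : 0 < 2 * Real.pi := by positivity
  rw [abs_mul, abs_of_pos (inv_pos.2 hπ), inv_mul_le_iff₀ hπ]
  refine h.trans ?_
  have key : cylRadius x * (D / (cylRadius x + Real.sqrt (-s))) ≤ D := by
    rw [mul_div_assoc', div_le_iff₀ (by positivity)]
    nlinarith
  nlinarith

/-- The circle term under the sign, the circle-averaged cone and the axis-Type-I bound:
`|T| ≤ (1+K)·D/(|x_h| + √(−s)) · ∮ω₃ dl`. -/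
theorem abs_circleTerm_le_axisBound (hsm : IsSmoothSpaceTimeOn (Iio (0 : ℝ)) v)
    (hDax : ∀ t < 0, ∀ x : EuclideanSpace ℝ (Fin 3), ‖v t x‖ ≤ D / (cylRadius x + Real.sqrt (-t))) (hsign : SignE3 v)
    (hK : ∀ s < 0, ∀ r : ℝ, 0 ≤ r → ∀ z : ℝ, tiltCirc v r z s ≤ K * vortCirc v r z s) {s : ℝ} (hs : s < 0)
    (x : EuclideanSpace ℝ (Fin 3)) :
    |circleTerm v (cylRadius x) (x 2) s| ≤
      (1 + K) * (D / (cylRadius x + Real.sqrt (-s))) * vortCirc v (cylRadius x) (x 2) s := by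
  have hv1 : ContDiff ℝ 1 (v s) := (hsm.contDiff_slice hs).of_le (by norm_cast)
  have hD0 : 0 ≤ D := axisBound_nonneg hDax
  have hr := cylRadius_nonneg x
  have hB : ∀ θ : ℝ, ‖v s (cylPt (cylRadius x) θ (x 2))‖ ≤ D / (cylRadius x + Real.sqrt (-s)) :=
    fun θ => norm_le_on_circle_of_axisBound hDax hs hr θ (x 2)
  have hsq : 0 < Real.sqrt (-s) := Real.sqrt_pos.2 (by linarith)
  exact abs_circleTerm_le_cone hv1 (fun y => hsign s hs y) hr hB (by positivity) (hK s hs (cylRadius x) hr (x 2))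

/-! ### The sourced swirl triple and the census theorem, axis-Type-I version -/

/-- **`(F, 0, β)` is a sourced swirl triple** (`C_f = D`, `C_u = 0`, `A = (1+K)D`, `τ = 0`) under the axis-Type-I bound,
for any jointly measurable `β` with `β ∮ω₃ = T` and `|β| ≤ (1+K)D/(r+√(−s))`. -/
theorem isSourcedSwirl_circF_of_axisBound (hrate : HasTypeITimeDecay C v)
    (hcont : ContinuousOn (uncurry v) (Iio (0 : ℝ) ×ˢ univ))
    (hmild : ∀ s t : ℝ, s < t → t < 0 → ∀ x,
      v t x = UnboundedOperators.heatExtension (v s) (t - s) x - oseenDuhamel 1 s v v t x)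
    (hdiv : ∀ t < 0, VectorCalculus.IsDivFree (v t)) (hDax : ∀ t < 0, ∀ x : EuclideanSpace ℝ (Fin 3), ‖v t x‖ ≤ D / (cylRadius x + Real.sqrt (-t))) (hsign : SignE3 v) (hK0 : 0 ≤ K)
    {β : ℝ → EuclideanSpace ℝ (Fin 3) → ℝ} (hβm : Measurable (uncurry β))
    (hβT : ∀ s < 0, ∀ x : EuclideanSpace ℝ (Fin 3),
      β s x * vortCirc v (cylRadius x) (x 2) s = circleTerm v (cylRadius x) (x 2) s)
    (hβle : ∀ s < 0, ∀ x : EuclideanSpace ℝ (Fin 3), |β s x| ≤ (1 + K) * (D / (cylRadius x + Real.sqrt (-s)))) :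
    IsSourcedSwirl D 0 ((1 + K) * D) 0
      (fun s (x : EuclideanSpace ℝ (Fin 3)) => (2 * Real.pi)⁻¹ * circ v (cylRadius x) (x 2) s)
      (fun _ _ => 0) β := by
  have hsm : IsSmoothSpaceTimeOn (Iio (0 : ℝ)) v := isSmoothSpaceTimeOn_of_class hrate hcont hmild hdiv
  have hD0 : 0 ≤ D := axisBound_nonneg hDax
  have hSF := isSmoothSpaceTimeOn_circF hsm
  refine ⟨?_, ?_, ?_, ?_, ?_, ?_, ?_, ?_, ?_, ?_, ?_, hβm, by positivity, ?_, ?_, ?_⟩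
  · intro t ht; exact contDiff_circF (hsm.contDiff_slice ht)
  · exact hSF.continuousOn_fderiv_slice (uniqueDiffOn_Iio 0)
  · exact (hSF.laplacian (uniqueDiffOn_Iio 0)).continuousOn
  · intro t _; exact isAxisymmetricScalar_circF v t
  · intro t _ x hx; exact circF_axis v t hx
  · intro t ht x; exact abs_circF_le_of_axisBound hDax ht x
  · intro t ht x; exact fderiv_circF_eR_nonneg hsm hsign ht x
  · exact measurable_const
  · intro t _; exact contDiff_const
  · intro t _ x; simp [VectorCalculus.divergence]
  · intro t _ x; simp
  · intro t ht x
    have h := hβle t ht x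
    have hsq : 0 < Real.sqrt (-t) := Real.sqrt_pos.2 (by linarith)
    have hr := cylRadius_nonneg x
    calc |β t x| * cylRadius x ≤ (1 + K) * (D / (cylRadius x + Real.sqrt (-t))) * cylRadius x :=
          mul_le_mul_of_nonneg_right h hr
      _ ≤ (1 + K) * D := by
          rw [mul_assoc]
          refine mul_le_mul_of_nonneg_left ?_ (by positivity)
          rw [div_mul_eq_mul_div, div_le_iff₀ (by positivity)]
          nlinarith
  · intro t ht x
    have h := hβle t ht x
    have hsq : 0 < Real.sqrt (-t) := Real.sqrt_pos.2 (by linarith)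
    have hr := cylRadius_nonneg x
    rw [zero_sub]
    calc |β t x| * Real.sqrt (-t) ≤ (1 + K) * (D / (cylRadius x + Real.sqrt (-t))) * Real.sqrt (-t) :=
          mul_le_mul_of_nonneg_right h hsq.le
      _ ≤ (1 + K) * D := by
          rw [mul_assoc]
          refine mul_le_mul_of_nonneg_left ?_ (by positivity)
          rw [div_mul_eq_mul_div, div_le_iff₀ (by positivity)]
          nlinarith
  · intro x hx s t hst ht
    exact circF_eqn hrate hcont hmild hdiv hβT hx hst ht


/-- **TILT-DOMINATED CLOSED-HEMISPHERE PROFILES WITH THE AXIS-TYPE-I BOUND ARE TRIVIAL** (unconditional; strict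
generalisation of `…TiltDominatedLiouville.eq_zero_of_hasTypeIDecay_signE3_globalCone`: no axial decay is assumed). -/
theorem eq_zero_of_axisTypeI_signE3_globalCone (C D : ℝ) (v : ℝ → EuclideanSpace ℝ (Fin 3) → EuclideanSpace ℝ (Fin 3))
    (hrate : HasTypeITimeDecay C v)
    (hcont : ContinuousOn (uncurry v) (Iio (0 : ℝ) ×ˢ univ))
    (hmild : ∀ s t : ℝ, s < t → t < 0 → ∀ x,
      v t x = UnboundedOperators.heatExtension (v s) (t - s) x - oseenDuhamel 1 s v v t x)
    (hdiv : ∀ t < 0, VectorCalculus.IsDivFree (v t)) (hDax : ∀ t < 0, ∀ x : EuclideanSpace ℝ (Fin 3), ‖v t x‖ ≤ D / (cylRadius x + Real.sqrt (-t)))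
    (hsign : ∀ s < 0, ∀ y, 0 ≤ ⟪curl (v s) y, (EuclideanSpace.single (2 : Fin 3) (1 : ℝ))⟫_ℝ)
    (hcone : GlobalCone v) : ∀ t < 0, ∀ x, v t x = 0 := by
  have hsm : IsSmoothSpaceTimeOn (Iio (0 : ℝ)) v := isSmoothSpaceTimeOn_of_class hrate hcont hmild hdiv
  have hsign' : SignE3 v := hsign
  obtain ⟨K, hK0, hK⟩ := tiltCirc_le_of_globalCone hcone
  -- the extra radial drift `β = T / ∮ω₃` (zero off the slab), jointly measurable
  set Slab : Set (ℝ × EuclideanSpace ℝ (Fin 3)) := {p | p.1 < 0} with hSlab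
  have hSlabm : MeasurableSet Slab := measurableSet_lt measurable_fst measurable_const
  set Tf : ℝ × EuclideanSpace ℝ (Fin 3) → ℝ := fun p => circleTerm v (cylRadius p.2) (p.2 2) p.1 with hTf
  set Df : ℝ × EuclideanSpace ℝ (Fin 3) → ℝ := fun p => vortCirc v (cylRadius p.2) (p.2 2) p.1 with hDf
  have hq2 : Continuous fun p : ℝ × EuclideanSpace ℝ (Fin 3) => p.2 2 :=
    (PiLp.continuous_apply 2 (fun _ : Fin 3 => ℝ) (2 : Fin 3)).comp continuous_snd
  have hq : Continuous fun p : ℝ × EuclideanSpace ℝ (Fin 3) => ((cylRadius p.2, p.2 2, p.1) : ℝ × ℝ × ℝ) :=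
    (continuous_cylRadius.comp continuous_snd).prodMk (hq2.prodMk continuous_fst)
  have hmaps : MapsTo (fun p : ℝ × EuclideanSpace ℝ (Fin 3) => ((cylRadius p.2, p.2 2, p.1) : ℝ × ℝ × ℝ)) Slab
      {q : ℝ × ℝ × ℝ | q.2.2 < 0} := fun p hp => hp
  have hTc : ContinuousOn Tf Slab := by
    have h := (continuousOn_circleTerm hsm).comp hq.continuousOn hmaps
    simpa only [Function.comp_def] using h
  have hDc : ContinuousOn Df Slab := by
    have h := (continuousOn_vortCirc hsm).comp hq.continuousOn hmaps
    simpa only [Function.comp_def] using h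
  have hTm : Measurable (Slab.piecewise Tf 0) := hTc.measurable_piecewise continuousOn_const hSlabm
  have hDm : Measurable (Slab.piecewise Df 0) := hDc.measurable_piecewise continuousOn_const hSlabm
  set β : ℝ → EuclideanSpace ℝ (Fin 3) → ℝ := fun s x => Slab.piecewise Tf 0 (s, x) / Slab.piecewise Df 0 (s, x) with hβ
  have hβm : Measurable (uncurry β) := by
    have e : uncurry β = fun p => Slab.piecewise Tf 0 p / Slab.piecewise Df 0 p := by
      funext p; rfl
    rw [e]; exact hTm.div hDm
  have hβval : ∀ s < 0, ∀ x : EuclideanSpace ℝ (Fin 3),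
      β s x = circleTerm v (cylRadius x) (x 2) s / vortCirc v (cylRadius x) (x 2) s := by
    intro s hs x
    have hmem : ((s, x) : ℝ × EuclideanSpace ℝ (Fin 3)) ∈ Slab := hs
    show Slab.piecewise Tf 0 (s, x) / Slab.piecewise Df 0 (s, x) = _
    rw [Set.piecewise_eq_of_mem _ _ _ hmem, Set.piecewise_eq_of_mem _ _ _ hmem]
  -- pointwise: `β ∮ω₃ = T` and `|β| ≤ (1+K) D/(r+√(−s))`
  have hT : ∀ s < 0, ∀ x : EuclideanSpace ℝ (Fin 3), |circleTerm v (cylRadius x) (x 2) s| ≤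
      (1 + K) * (D / (cylRadius x + Real.sqrt (-s))) * vortCirc v (cylRadius x) (x 2) s :=
    fun s hs x => abs_circleTerm_le_axisBound hsm hDax hsign' hK hs x
  have hvort : ∀ s < 0, ∀ x : EuclideanSpace ℝ (Fin 3), 0 ≤ vortCirc v (cylRadius x) (x 2) s :=
    fun s hs x => vortCirc_nonneg v hsign' hs (cylRadius_nonneg x) _
  have hβT : ∀ s < 0, ∀ x : EuclideanSpace ℝ (Fin 3),
      β s x * vortCirc v (cylRadius x) (x 2) s = circleTerm v (cylRadius x) (x 2) s := by
    intro s hs x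
    rw [hβval s hs x]
    by_cases h0 : vortCirc v (cylRadius x) (x 2) s = 0
    · have h := hT s hs x
      rw [h0, mul_zero] at h
      rw [h0, mul_zero, eq_comm]
      exact abs_nonpos_iff.1 h
    · field_simp
  have hβle : ∀ s < 0, ∀ x : EuclideanSpace ℝ (Fin 3), |β s x| ≤ (1 + K) * (D / (cylRadius x + Real.sqrt (-s))) := by
    intro s hs x
    have hD0 : 0 ≤ D := axisBound_nonneg hDax
    have hsq : 0 < Real.sqrt (-s) := Real.sqrt_pos.2 (by linarith)
    have hnn : 0 ≤ (1 + K) * (D / (cylRadius x + Real.sqrt (-s))) := by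
      have := cylRadius_nonneg x; positivity
    rw [hβval s hs x]
    by_cases h0 : vortCirc v (cylRadius x) (x 2) s = 0
    · rw [h0, div_zero, abs_zero]; exact hnn
    have hpos : 0 < vortCirc v (cylRadius x) (x 2) s := lt_of_le_of_ne (hvort s hs x) (Ne.symm h0)
    rw [abs_div, abs_of_pos hpos, div_le_iff₀ hpos]
    exact hT s hs x
  -- the sourced swirl triple and its Liouville theorem: `F ≡ 0`
  have hS := isSourcedSwirl_circF_of_axisBound hrate hcont hmild hdiv hDax hsign' hK0 hβm hβT hβle
  have hFnn : ∀ t < 0, ∀ x : EuclideanSpace ℝ (Fin 3), 0 ≤ (2 * Real.pi)⁻¹ * circ v (cylRadius x) (x 2) t := by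
    intro t ht x
    have hv1 : ContDiff ℝ 1 (v t) := (hsm.contDiff_slice ht).of_le (by norm_cast)
    exact mul_nonneg (by positivity) (circ_nonneg (v := v) hv1 hsign' ht (cylRadius_nonneg x) _)
  have hF0 := IsSourcedSwirl.eq_zero_of_nonneg hS hFnn
  -- `Γ ≡ 0` on the apex window of the slice `s = -1`, hence `v ≡ 0`
  refine eq_zero_of_signE3_globalCone_circ_eq_zero hrate hcont hmild hdiv hsign' hcone
    (show (-1 : ℝ) < 0 by norm_num) one_pos fun r hr z _ => ?_
  have h := hF0 (-1) (by norm_num) (cylPt r 0 z)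
  rw [cylRadius_cylPt hr.1.le] at h
  have hz : (cylPt r 0 z) 2 = z := by simp [cylPt]
  rw [hz] at h
  have hπ : (2 * Real.pi)⁻¹ ≠ 0 := by positivity
  exact (mul_eq_zero.1 h).resolve_left hπ


/-- The space–time Type-I subclass is contained in the axis-Type-I class (`|x_h| ≤ ‖x‖`), so the earlier census theorem is
a special case. -/
theorem axisBound_of_hasTypeIDecay (hD : HasTypeIDecay D v) :
    ∀ t < 0, ∀ x : EuclideanSpace ℝ (Fin 3), ‖v t x‖ ≤ D / (cylRadius x + Real.sqrt (-t)) := by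
  intro t ht x
  have hD0 : 0 ≤ D := typeIDecay_nonneg hD ht
  have hsq : 0 < Real.sqrt (-t) := Real.sqrt_pos.2 (by linarith)
  refine (hD t ht x).trans (div_le_div_of_nonneg_left hD0 (by positivity [cylRadius_nonneg x]) ?_)
  have : cylRadius x ≤ ‖x‖ := by
    have h1 : cylRadius x ^ 2 ≤ ‖x‖ ^ 2 := by
      rw [cylRadius_sq, EuclideanSpace.real_norm_sq_eq, Fin.sum_univ_three]
      nlinarith [sq_nonneg (x 2)]
    exact (pow_le_pow_iff_left₀ (cylRadius_nonneg x) (norm_nonneg x) two_ne_zero).1 h1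
  linarith

end Summit.NavierStokesRegularity.NavierStokesRegularity.Theorems.HalfSpaceWindowDoorCirculationCarryingRigidityAxisTypeILiouville

end
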